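import Literature.Barriers.CriticalPhenomena.LaceExpansionGaussianHeatKernel
import Mathlib.Analysis.SpecialFunctions.Gamma.Basic
import HarnessLib

/-!
# Hara's Theorem 1.3 assembled from Lemmas 2.2 and 2.3 (Hara 2008, §2.1 and §2.6)

Barrier catalogue `Literature/Barriers/CriticalPhenomena/` (D-0021). The named fact
`Hara2008_thm13` (`LaceExpansionGaussianLemma.lean`: Hara 2008, Thm. 1.3 with the error bound
(1.20a)) — the analytic leaf of the reduction of `Hara2008_etaZeroXSpace` (Heydenreich–van der
Hofstad 2017, Thm. 11.4) — is reduced here to the two lemmas of its printed proof, each vendored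
as a named fact over the objects `haraI` (`I_t(x)`, `LaceExpansionGaussianHeatKernel.lean`) and
`gaussMain` (the Gaussian main term `(d/(2πK₁t))^{d/2} e^{-d|x|²/(2tK₁)}`):

* `Hara2008_lem22` — Lemma 2.2 (the contribution from large `t`: `I_t(x) =` Gaussian `+ R₃(t)`)
  in the quantitative form of §2.6, `|R₃(t)| ≤ c t^{-(d+ρ∧2)/2}` for `t ≥ 1`;
* `Hara2008_lem23` — Lemma 2.3 (the contribution from small `t`) in the case `m = d`, `n⃗ = 0`
  used in the proof: `|I_t(x)| ≤ c₆ ⟦x⟧^{-d}`;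

and the passage from them to Thm. 1.3 — §2.1 (2.3)–(2.8) with the choice `T = |x|^{2-(ρ∧2)/d}`
of §2.6 (2.47)–(2.49) — is PROVED (`Hara2008_thm13_of_lemmas`), including the Gaussian time
integrals: `∫₀^∞ (d/(2πK₁t))^{d/2} e^{-d r²/(2tK₁)} dt = (a_d/K₁) r^{2-d}` with
`a_d = dΓ(d/2-1)/(2π^{d/2})` (`integral_gaussMain`, substitution `t = 1/y` and Euler's integral),
and `R₄ ≤ T (d/(2πe r²))^{d/2}` from `y^{-β}e^{-α/y} ≤ (β/(αe))^β` (`gaussMain_le`, by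
`log u ≤ u - 1`).

So the trust base of `Hara2008_etaZeroXSpace` is now: `Hara2008_lem22`, `Hara2008_lem23` (pure
Fourier analysis on `[-π,π]^d`: Lemma 2.1, Gaussian integrals on `ℝ^d`, `d` integrations by parts
and Lemma 6.1(iii)) and the lace-expansion inputs of `LaceExpansionPcInputs.lean`.

## References

* T. Hara, Ann. Probab. 36 (2008) 530–593 (arXiv:math-ph/0504021): §2.1 ((2.1)–(2.8)),
  Lemma 2.2 (2.12) and the proof of (2.5) ((2.14)–(2.18)), Lemma 2.3 (2.26) and the proof of
  (2.6), §2.6 ((2.47)–(2.49)).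
-/

noncomputable section

namespace Literature.Barriers.CriticalPhenomena

open MeasureTheory Filter Finset Literature.Probability.LatticeModels Literature.Probability.Percolation
open scoped Topology BigOperators

variable {d : ℕ}

/-! ### The Gaussian main term and the two lemmas as named facts -/

/-- The Gaussian main term of `I_t(x)`: `(d/(2πK₁t))^{d/2} exp(-d|x|²/(2tK₁))`, as a function of
`t` and `r = |x|`. [cite: Hara2008, Lemma 2.2 (2.12)] -/
def gaussMain (d : ℕ) (K₁ t r : ℝ) : ℝ :=
  ((d : ℝ) / (2 * Real.pi * K₁ * t)) ^ ((d : ℝ) / 2) * Real.exp (-((d : ℝ) * r ^ 2 / (2 * t * K₁)))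

/-- NAMED FACT — **Hara 2008, Lemma 2.2 in the quantitative form of §2.6.** Lemma 2.2: "Fix
`ε > 0` and assume (1.18)–(1.19) of Theorem 1.3. Then we have for `t ≥ 1/ε`:
`I_t(x) = (d/(2πK₁t))^{d/2} exp(-d|x|²/(2tK₁)) + R₃(t)` with
`|R₃(t)| ≤ o(t^{-d/2}) + c₅e^{-c₂/ε}t^{-d/2}`"; §2.6: "Improved bound (1.19') on `J(x)` improves
several estimates … the error term `R̂₂(k)` of Lemma 2.1 now obeys `|R̂₂(k)| ≤ (K₂'/2)|k|^{2+(ρ∧2)}`.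
Taking `k_t = t^{-1/(2+ρ∧2)}` and using this new bound on `R̂₂(k)` improves Lemma 2.2's error bound
as `|R₃(t)| ≤ c t^{-(d+ρ∧2)/2}`." Vendored in the latter form, for `t ≥ 1` (where
`k_t ≤ 1`), uniformly in `x ∈ ℤ^d`, under the bundle `HaraKernelHyp d J ρ` ((1.18)–(1.19'));
`K₁ = Σ_y |y|²J(y)`, `I_t = haraI`. Users take `(h : Hara2008_lem22)`.
[cite: Hara2008, Lemma 2.2 (2.12) and §2.6 (the improved bound |R₃(t)| ≤ c t^{-(d+ρ∧2)/2})] -/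
def Hara2008_lem22 : Prop :=
  ∀ (d : ℕ), 3 ≤ d → ∀ (J : Site d → ℝ) (ρ : ℝ), HaraKernelHyp d J ρ →
    ∃ c : ℝ, ∀ t : ℝ, 1 ≤ t → ∀ x : Site d,
      ‖haraI J t x - (gaussMain d (∑' y, euclidNorm y ^ 2 * J y) t (euclidNorm x) : ℂ)‖ ≤
        c * t ^ (-(((d : ℝ) + min ρ 2) / 2))

/-- NAMED FACT — **Hara 2008, Lemma 2.3, the case `m = d`, `n⃗ = 0`.** Lemma 2.3: "Under the
assumption of Theorem 1.3, we have for integers `m ∈ [0, d]` and `n₁, …, n_d ≥ 0`: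
`|(I_t * Π*_{j=1}^d J_j^{(*n_j)})(x)| ≤ c₆(m, n⃗) t^{-(d+n-m)/2}/⟦x⟧^m` with `n := Σ_j n_j`, where
`c₆(m, n⃗)` is a calculable constant depending on `K_i, d, m` and `n⃗`." Only the case used in the
proof of Thm. 1.3 is vendored ("By (2.26) with `n⃗ = 0` and `m = d`, we have
`|I_t(x)| ≤ c₆(d, 0⃗)⟦x⟧^{-d}`"): for all `t > 0` and `x`, under `HaraKernelHyp d J ρ` (which
contains (1.18)–(1.19)). Users take `(h : Hara2008_lem23)`.
[cite: Hara2008, Lemma 2.3 (2.26) and the proof of (2.6) given Lemma 2.3] -/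
def Hara2008_lem23 : Prop :=
  ∀ (d : ℕ), 3 ≤ d → ∀ (J : Site d → ℝ) (ρ : ℝ), HaraKernelHyp d J ρ →
    ∃ c₆ : ℝ, ∀ t : ℝ, 0 < t → ∀ x : Site d, ‖haraI J t x‖ ≤ c₆ * jnorm x ^ (-(d : ℝ))

/-! ### The Gaussian time integrals -/

/-- The main term factorised: `(d/(2πK₁t))^{d/2} e^{-dr²/(2tK₁)} = (d/(2πK₁))^{d/2} · t^{-d/2} e^{-α/t}`
with `α = dr²/(2K₁)`. [folklore] -/
theorem gaussMain_eq (d : ℕ) {K₁ t : ℝ} (hK : 0 < K₁) (ht : 0 < t) (r : ℝ) :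
    gaussMain d K₁ t r = ((d : ℝ) / (2 * Real.pi * K₁)) ^ ((d : ℝ) / 2) *
      (t ^ (-((d : ℝ) / 2)) * Real.exp (-((d : ℝ) * r ^ 2 / (2 * K₁) / t))) := by
  have hApos : 0 ≤ (d : ℝ) / (2 * Real.pi * K₁) := by positivity
  unfold gaussMain
  rw [show (d : ℝ) / (2 * Real.pi * K₁ * t) = (d : ℝ) / (2 * Real.pi * K₁) / t by field_simp,
    Real.div_rpow hApos ht.le, Real.rpow_neg ht.le,
    show (d : ℝ) * r ^ 2 / (2 * t * K₁) = (d : ℝ) * r ^ 2 / (2 * K₁) / t by field_simp]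
  ring

/-- `∫₀^∞ t^{-β} e^{-α/t} dt = α^{1-β} Γ(β-1)` for `α > 0`, `β > 1` (substitute `t = 1/y`).
[cite: Hara2008, proof of (2.5), display (2.16)] -/
theorem integral_rpow_neg_mul_exp_neg_div {α β : ℝ} (hα : 0 < α) (hβ : 1 < β) :
    ∫ t in Set.Ioi (0 : ℝ), t ^ (-β) * Real.exp (-(α / t)) = (1 / α) ^ (β - 1) * Real.Gamma (β - 1) := by
  have hsub := integral_comp_rpow_Ioi (fun y : ℝ => y ^ (β - 2) * Real.exp (-(α * y))) (p := -1) (by norm_num)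
  have hpt : Set.EqOn (fun x : ℝ => (|(-1 : ℝ)| * x ^ ((-1 : ℝ) - 1)) • ((x ^ (-1 : ℝ)) ^ (β - 2) * Real.exp (-(α * x ^ (-1 : ℝ)))))
      (fun t => t ^ (-β) * Real.exp (-(α / t))) (Set.Ioi 0) := by
    intro x hx
    have hx0 : (0 : ℝ) < x := hx
    simp only [smul_eq_mul, abs_neg, abs_one, one_mul]
    rw [Real.rpow_neg_one, ← Real.rpow_neg_one x, ← Real.rpow_mul hx0.le, ← mul_assoc,
      ← Real.rpow_add hx0]
    congr 1
    · ring_nf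
    · rw [Real.rpow_neg_one, div_eq_mul_inv]
  rw [← setIntegral_congr_fun measurableSet_Ioi hpt, hsub]
  have h := Real.integral_rpow_mul_exp_neg_mul_Ioi (a := β - 1) (r := α) (by linarith) hα
  rw [show β - 1 - 1 = β - 2 by ring] at h
  exact h

/-- **The total Gaussian time integral**:
`∫₀^∞ (d/(2πK₁t))^{d/2} e^{-d r²/(2tK₁)} dt = (a_d/K₁) r^{2-d}`, `a_d = dΓ(d/2-1)/(2π^{d/2})`
(`d ≥ 3`, `K₁, r > 0`). [cite: Hara2008, proof of (2.5), display (2.16)] -/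
theorem integral_gaussMain (hd : 3 ≤ d) {K₁ r : ℝ} (hK : 0 < K₁) (hr : 0 < r) :
    ∫ t in Set.Ioi (0 : ℝ), gaussMain d K₁ t r = gaussianAmp d / K₁ * r ^ (2 - (d : ℝ)) := by
  have hd3 : (3 : ℝ) ≤ d := by exact_mod_cast hd
  have hd0 : (0 : ℝ) < d := by linarith
  set β : ℝ := (d : ℝ) / 2 with hβ
  have hβ1 : 1 < β := by rw [hβ]; linarith
  set α : ℝ := (d : ℝ) * r ^ 2 / (2 * K₁) with hα
  have hα0 : 0 < α := by positivity
  set A : ℝ := ((d : ℝ) / (2 * Real.pi * K₁)) ^ β with hA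
  have hApos : 0 < (d : ℝ) / (2 * Real.pi * K₁) := by positivity
  -- rewrite the integrand
  have hpt : Set.EqOn (fun t => gaussMain d K₁ t r) (fun t => A * (t ^ (-β) * Real.exp (-(α / t)))) (Set.Ioi 0) := by
    intro t ht
    have ht0 : (0 : ℝ) < t := ht
    simp only [hA, hβ, hα]
    exact gaussMain_eq d hK ht0 r
  rw [setIntegral_congr_fun measurableSet_Ioi hpt, integral_const_mul,
    integral_rpow_neg_mul_exp_neg_div hα0 hβ1]
  -- the algebra of the constants
  have hβm : β - 1 = ((d : ℝ) - 2) / 2 := by rw [hβ]; ring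
  rw [gaussianAmp, show (d : ℝ) / 2 - 1 = β - 1 by rw [hβ]]
  have hπ := Real.pi_pos
  -- `A (1/α)^{β-1} = (d/(2πK₁)) · (1/(π r²))^{β-1}`
  have h1 : A * (1 / α) ^ (β - 1) = (d : ℝ) / (2 * Real.pi * K₁) * (1 / (Real.pi * r ^ 2)) ^ (β - 1) := by
    rw [hA, show β = 1 + (β - 1) by ring, Real.rpow_add hApos, Real.rpow_one, show 1 + (β - 1) - 1 = β - 1 by ring,
      mul_assoc, ← Real.mul_rpow hApos.le (by positivity)]
    congr 2
    rw [hα]; field_simp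
  have h2 : (1 / (Real.pi * r ^ 2)) ^ (β - 1) = (Real.pi ^ β)⁻¹ * Real.pi * r ^ (2 - (d : ℝ)) := by
    rw [one_div, Real.inv_rpow (by positivity), Real.mul_rpow hπ.le (by positivity),
      show (r ^ 2) ^ (β - 1) = r ^ ((d : ℝ) - 2) by
        rw [show r ^ 2 = r ^ (2 : ℝ) by norm_cast, ← Real.rpow_mul hr.le]; congr 1; rw [hβ]; ring,
      show Real.pi ^ (β - 1) = Real.pi ^ β / Real.pi by rw [Real.rpow_sub_one hπ.ne'],
      show r ^ (2 - (d : ℝ)) = (r ^ ((d : ℝ) - 2))⁻¹ by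
        rw [← Real.rpow_neg hr.le]; congr 1; ring]
    field_simp
  calc A * ((1 / α) ^ (β - 1) * Real.Gamma (β - 1))
      = (A * (1 / α) ^ (β - 1)) * Real.Gamma (β - 1) := by ring
    _ = (d : ℝ) / (2 * Real.pi * K₁) * ((Real.pi ^ β)⁻¹ * Real.pi * r ^ (2 - (d : ℝ))) * Real.Gamma (β - 1) := by
        rw [h1, h2]
    _ = (d : ℝ) * Real.Gamma (β - 1) / (2 * Real.pi ^ β) / K₁ * r ^ (2 - (d : ℝ)) := by
        field_simp
    _ = _ := by rw [hβ]

/-- The Gaussian main term is integrable on `(0, ∞)` (its integral is the positive number above).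
[folklore] -/
theorem integrableOn_gaussMain (hd : 3 ≤ d) {K₁ r : ℝ} (hK : 0 < K₁) (hr : 0 < r) :
    IntegrableOn (fun t => gaussMain d K₁ t r) (Set.Ioi 0) := by
  by_contra h
  have h0 := integral_undef h
  rw [integral_gaussMain hd hK hr] at h0
  have hpos : 0 < gaussianAmp d / K₁ * r ^ (2 - (d : ℝ)) :=
    mul_pos (div_pos (gaussianAmp_pos hd) hK) (Real.rpow_pos_of_pos hr _)
  linarith

/-- `gaussMain ≥ 0`. [folklore] -/
theorem gaussMain_nonneg (d : ℕ) {K₁ t : ℝ} (hK : 0 ≤ K₁) (ht : 0 ≤ t) (r : ℝ) : 0 ≤ gaussMain d K₁ t r := by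
  unfold gaussMain
  have : 0 ≤ (d : ℝ) / (2 * Real.pi * K₁ * t) := by positivity
  positivity

/-- **Uniform bound on the Gaussian main term**: `y^{-β}e^{-α/y} ≤ (β/(αe))^β` ("valid for
`α, β, y > 0`") gives `(d/(2πK₁t))^{d/2} e^{-d r²/(2tK₁)} ≤ (d/(2πe r²))^{d/2}` for all `t > 0`.
[cite: Hara2008, proof of (2.5), displays (2.17)–(2.18)] -/
theorem gaussMain_le (hd : 1 ≤ d) {K₁ t r : ℝ} (hK : 0 < K₁) (ht : 0 < t) (hr : 0 < r) :
    gaussMain d K₁ t r ≤ ((d : ℝ) / (2 * Real.pi * Real.exp 1 * r ^ 2)) ^ ((d : ℝ) / 2) := by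
  have hd0 : (0 : ℝ) < d := by exact_mod_cast (show 0 < d by omega)
  set β : ℝ := (d : ℝ) / 2 with hβ
  have hβ0 : 0 < β := by positivity
  set α : ℝ := (d : ℝ) * r ^ 2 / (2 * K₁) with hα
  have hα0 : 0 < α := by positivity
  have hπ := Real.pi_pos
  -- the one-variable inequality `t^{-β} e^{-α/t} ≤ (β/(α e))^β`, via `log u ≤ u - 1`
  set s : ℝ := α / t with hs
  have hs0 : 0 < s := by positivity
  have hkey : t ^ (-β) * Real.exp (-(α / t)) ≤ (β / (α * Real.exp 1)) ^ β := by
    have hlog : Real.log (s / β) ≤ s / β - 1 := Real.log_le_sub_one_of_pos (by positivity)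
    have hlog' : β * Real.log s - s ≤ β * Real.log β - β := by
      rw [Real.log_div hs0.ne' hβ0.ne'] at hlog
      have := mul_le_mul_of_nonneg_left hlog hβ0.le
      have e : β * (s / β - 1) = s - β := by field_simp
      nlinarith [this, e]
    have hlhs : t ^ (-β) * Real.exp (-(α / t)) = Real.exp (β * Real.log s - s - β * Real.log α) := by
      rw [Real.rpow_def_of_pos ht, ← Real.exp_add]
      congr 1
      have : Real.log s = Real.log α - Real.log t := by rw [hs, Real.log_div hα0.ne' ht.ne']
      rw [this, ← hs]; ring
    have hrhs : (β / (α * Real.exp 1)) ^ β = Real.exp (β * Real.log β - β - β * Real.log α) := by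
      rw [Real.rpow_def_of_pos (by positivity), Real.log_div hβ0.ne' (by positivity),
        Real.log_mul hα0.ne' (Real.exp_pos 1).ne', Real.log_exp]
      congr 1; ring
    rw [hlhs, hrhs]
    exact Real.exp_le_exp.2 (by linarith)
  -- assemble
  have hApos : 0 < (d : ℝ) / (2 * Real.pi * K₁) := by positivity
  have hmain : gaussMain d K₁ t r = ((d : ℝ) / (2 * Real.pi * K₁)) ^ β * (t ^ (-β) * Real.exp (-(α / t))) := by
    simp only [hβ, hα]
    exact gaussMain_eq d hK ht r
  rw [hmain]
  calc ((d : ℝ) / (2 * Real.pi * K₁)) ^ β * (t ^ (-β) * Real.exp (-(α / t)))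
      ≤ ((d : ℝ) / (2 * Real.pi * K₁)) ^ β * (β / (α * Real.exp 1)) ^ β :=
        mul_le_mul_of_nonneg_left hkey (Real.rpow_nonneg hApos.le _)
    _ = ((d : ℝ) / (2 * Real.pi * K₁) * (β / (α * Real.exp 1))) ^ β := by
        rw [Real.mul_rpow hApos.le (by positivity)]
    _ = ((d : ℝ) / (2 * Real.pi * Real.exp 1 * r ^ 2)) ^ β := by
        congr 1
        rw [hβ, hα]; field_simp


/-! ### Theorem 1.3 from Lemmas 2.2 and 2.3 -/

/-- Splitting an integral over `(0, ∞)` at `T > 0`. [folklore] -/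
theorem integral_Ioi_eq_Ioc_add_Ioi {f : ℝ → ℂ} (hf : IntegrableOn f (Set.Ioi 0)) {T : ℝ} (hT : 0 < T) :
    ∫ t in Set.Ioi (0 : ℝ), f t = (∫ t in Set.Ioc 0 T, f t) + ∫ t in Set.Ioi T, f t := by
  rw [← setIntegral_union Set.Ioc_disjoint_Ioi_same measurableSet_Ioi
    (hf.mono_set Set.Ioc_subset_Ioi_self) (hf.mono_set (Set.Ioi_subset_Ioi hT.le)),
    Set.Ioc_union_Ioi_eq_Ioi hT.le]

/-- The same splitting for a real integrand. [folklore] -/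
theorem integral_Ioi_eq_Ioc_add_Ioi_real {f : ℝ → ℝ} (hf : IntegrableOn f (Set.Ioi 0)) {T : ℝ} (hT : 0 < T) :
    ∫ t in Set.Ioi (0 : ℝ), f t = (∫ t in Set.Ioc 0 T, f t) + ∫ t in Set.Ioi T, f t := by
  rw [← setIntegral_union Set.Ioc_disjoint_Ioi_same measurableSet_Ioi
    (hf.mono_set Set.Ioc_subset_Ioi_self) (hf.mono_set (Set.Ioi_subset_Ioi hT.le)),
    Set.Ioc_union_Ioi_eq_Ioi hT.le]
set_option maxHeartbeats 400000 in -- buildfix (bf3-g27): 160k/180k FAIL, 200k PASS at accept time; line-neutral budget line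
/-- **Hara 2008, Thm. 1.3 (second half, (1.20a)) from Lemmas 2.2 and 2.3, proved** — the
framework of §2.1 with the choices of §2.6: write `C(x) = ∫₀^∞ I_t(x) dt`
(`haraC_eq_integral_haraI`), split at `T = |x|^{2-(ρ∧2)/d}`; for `t < T` use Lemma 2.3
(`|I_t(x)| ≤ c₆⟦x⟧^{-d}`, so `|C_<(x)| ≤ c₆ T |x|^{-d}`); for `t ≥ T` use Lemma 2.2 in its
quantitative form (`I_t = ` Gaussian ` + O(t^{-(d+ρ∧2)/2})`, the error integrating to
`O(T^{1-(d+ρ∧2)/2})`), the total Gaussian time integral `(a_d/K₁)|x|^{2-d}`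
(`integral_gaussMain`) and the bound `R₄(x) ≤ T (2πe|x|²/d)^{-d/2}` (`gaussMain_le`); the three
errors are `O(|x|^{-(d-2+(ρ∧2)/d)})` because `T|x|^{-d} = |x|^{-(d-2+(ρ∧2)/d)}` and
`(2-(ρ∧2)/d)(1-(d+ρ∧2)/2) ≤ -(d-2+(ρ∧2)/d)` (`ρ∧2 ≤ d`).
[cite: Hara2008, §2.1 ((2.1)–(2.8)) and §2.6 ((2.47)–(2.49))] -/
theorem Hara2008_thm13_of_lemmas (h22 : Hara2008_lem22) (h23 : Hara2008_lem23) : Hara2008_thm13 := by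
  intro d hd J ρ hK
  -- data from the hypotheses
  have hd3 : (3 : ℝ) ≤ d := by exact_mod_cast hd
  have hd0 : (0 : ℝ) < d := by linarith
  have hd1 : 1 ≤ d := by omega
  have hJabs : Summable fun x => |J x| := hK.hasSum_one.summable.abs
  have hJe : ∀ x, J (-x) = J x := IsZdSymmetric.neg hK.symm
  obtain ⟨K₀, hK₀, hlow⟩ := hK.lower
  set K₁ : ℝ := ∑' y, euclidNorm y ^ 2 * J y with hK₁
  have hK₁0 : 0 < K₁ := hK.secondMoment_pos
  have hρ : 0 < ρ := hK.rho_pos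
  set ρ' : ℝ := min ρ 2 with hρ'
  have hρ'0 : 0 < ρ' := lt_min hρ two_pos
  have hρ'2 : ρ' ≤ 2 := min_le_right _ _
  set σ : ℝ := ρ' / d with hσ
  have hσ0 : 0 < σ := div_pos hρ'0 hd0
  have hσ1 : σ ≤ 2 / 3 := by
    rw [hσ, div_le_div_iff₀ hd0 (by norm_num : (0:ℝ) < 3)]; nlinarith
  have hσd : σ * d = ρ' := by rw [hσ]; field_simp
  -- the two lemmas
  obtain ⟨c, hc⟩ := h22 d hd J ρ hK
  obtain ⟨c₆, hc₆⟩ := h23 d hd J ρ hK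
  have hc0 : 0 ≤ c := by
    have h := hc 1 le_rfl 0
    rw [Real.one_rpow, mul_one] at h
    exact (norm_nonneg _).trans h
  have hc₆0 : 0 ≤ c₆ := by
    have h := hc₆ 1 one_pos 0
    rw [jnorm_zero, Real.one_rpow, mul_one] at h
    exact (norm_nonneg _).trans h
  -- exponents
  set a : ℝ := -(((d : ℝ) + ρ') / 2) with ha
  have ha1 : a < -1 := by rw [ha]; linarith
  have ha1' : a + 1 < 0 := by linarith
  set s : ℝ := (d : ℝ) - 2 + σ with hs
  -- the constant
  set M₀ : ℝ := ((d : ℝ) / (2 * Real.pi * Real.exp 1)) ^ ((d : ℝ) / 2) with hM₀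
  have hM₀0 : 0 ≤ M₀ := Real.rpow_nonneg (by positivity) _
  refine ⟨c₆ + c / (-(a + 1)) + M₀, 1, fun x hx => ?_⟩
  -- the point `x`, `r = |x| ≥ 1`, `T = r^{2-σ} ≥ 1`
  set r := euclidNorm x with hr
  have hr1 : 1 ≤ r := hx
  have hr0 : 0 < r := by linarith
  have hjx : jnorm x = r := jnorm_eq_euclidNorm hr1
  set T : ℝ := r ^ (2 - σ) with hT
  have hT1 : 1 ≤ T := Real.one_le_rpow hr1 (by linarith)
  have hT0 : 0 < T := by linarith
  -- the three functions of `t`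
  set I : ℝ → ℂ := fun t => haraI J t x with hI
  set G : ℝ → ℝ := fun t => gaussMain d K₁ t r with hG
  obtain ⟨hI_int, hC⟩ := haraC_eq_integral_haraI hd hJabs hJe hK₀ hlow x
  have hG_int : IntegrableOn G (Set.Ioi 0) := integrableOn_gaussMain hd hK₁0 hr0
  have hG_tot : ∫ t in Set.Ioi (0 : ℝ), G t = gaussianAmp d / K₁ * r ^ (2 - (d : ℝ)) :=
    integral_gaussMain hd hK₁0 hr0
  -- (E1) small `t`
  have hE1 : ‖∫ t in Set.Ioc 0 T, I t‖ ≤ c₆ * r ^ (-(d : ℝ)) * T := by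
    have h := norm_setIntegral_le_of_norm_le_const (f := I) (s := Set.Ioc 0 T) (μ := volume)
      (C := c₆ * r ^ (-(d : ℝ))) (by rw [Real.volume_Ioc]; exact ENNReal.ofReal_lt_top) fun t ht => by
        have := hc₆ t ht.1 x
        rwa [hjx] at this
    rwa [Real.volume_real_Ioc_of_le hT0.le, sub_zero] at h
  -- (E2) the error of Lemma 2.2 beyond `T`
  have hIG_int : IntegrableOn (fun t => I t - (G t : ℂ)) (Set.Ioi T) :=
    (hI_int.mono_set (Set.Ioi_subset_Ioi hT0.le)).sub
      ((hG_int.mono_set (Set.Ioi_subset_Ioi hT0.le)).ofReal)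
  have hpow_int : IntegrableOn (fun t : ℝ => c * t ^ a) (Set.Ioi T) :=
    (integrableOn_Ioi_rpow_of_lt ha1 hT0).const_mul c
  have hE2 : ‖∫ t in Set.Ioi T, (I t - (G t : ℂ))‖ ≤ c / (-(a + 1)) * T ^ (a + 1) := by
    have h1 : ‖∫ t in Set.Ioi T, (I t - (G t : ℂ))‖ ≤ ∫ t in Set.Ioi T, c * t ^ a := by
      refine norm_integral_le_of_norm_le hpow_int ?_
      refine (ae_restrict_iff' measurableSet_Ioi).2 (Filter.Eventually.of_forall fun t ht => ?_)
      have ht1 : 1 ≤ t := hT1.trans (le_of_lt ht)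
      have := hc t ht1 x
      simp only [hI, hG, hK₁, hr, ha, hρ'] at this ⊢
      exact this
    rw [integral_const_mul, integral_Ioi_rpow_of_lt ha1 hT0] at h1
    calc _ ≤ c * (-T ^ (a + 1) / (a + 1)) := h1
      _ = c / (-(a + 1)) * T ^ (a + 1) := by field_simp
  -- (E3) the Gaussian before `T`
  have hE3 : 0 ≤ ∫ t in Set.Ioc 0 T, G t ∧ ∫ t in Set.Ioc 0 T, G t ≤ M₀ * r ^ (-(d : ℝ)) * T := by
    constructor
    · exact setIntegral_nonneg measurableSet_Ioc fun t ht => gaussMain_nonneg d hK₁0.le ht.1.le r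
    · have hbd : ∀ t ∈ Set.Ioc (0 : ℝ) T, ‖G t‖ ≤ M₀ * r ^ (-(d : ℝ)) := by
        intro t ht
        rw [Real.norm_eq_abs, abs_of_nonneg (gaussMain_nonneg d hK₁0.le ht.1.le r)]
        refine (gaussMain_le hd1 hK₁0 ht.1 hr0).trans (le_of_eq ?_)
        rw [hM₀, show (d : ℝ) / (2 * Real.pi * Real.exp 1 * r ^ 2) =
            (d : ℝ) / (2 * Real.pi * Real.exp 1) / r ^ 2 by field_simp,
          Real.div_rpow (by positivity) (by positivity)]
        rw [show (r ^ 2) ^ ((d : ℝ) / 2) = r ^ (d : ℝ) by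
            rw [show r ^ 2 = r ^ (2 : ℝ) by norm_cast, ← Real.rpow_mul hr0.le]; congr 1; ring,
          Real.rpow_neg hr0.le, div_eq_mul_inv]
      have h := norm_setIntegral_le_of_norm_le_const (f := G) (s := Set.Ioc 0 T) (μ := volume)
        (C := M₀ * r ^ (-(d : ℝ))) (by rw [Real.volume_Ioc]; exact ENNReal.ofReal_lt_top) hbd
      rw [Real.volume_real_Ioc_of_le hT0.le, sub_zero, Real.norm_eq_abs] at h
      exact (le_abs_self _).trans h
  -- the decomposition of `C(x) - (a_d/K₁) r^{2-d}`
  have hsplitI := integral_Ioi_eq_Ioc_add_Ioi hI_int hT0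
  have hsplitG := integral_Ioi_eq_Ioc_add_Ioi_real hG_int hT0
  have hIoiT : ∫ t in Set.Ioi T, I t = (∫ t in Set.Ioi T, (G t : ℂ)) + ∫ t in Set.Ioi T, (I t - (G t : ℂ)) := by
    have hGc : IntegrableOn (fun t => (G t : ℂ)) (Set.Ioi T) :=
      (hG_int.mono_set (Set.Ioi_subset_Ioi hT0.le)).ofReal
    have h1 := integral_add hGc hIG_int
    have h2 : (fun t => (G t : ℂ) + (I t - (G t : ℂ))) = I := by funext t; ring
    rw [h2] at h1
    exact h1
  have hGT : ∫ t in Set.Ioi T, (G t : ℂ) =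
      ((gaussianAmp d / K₁ * r ^ (2 - (d : ℝ)) : ℝ) : ℂ) - ((∫ t in Set.Ioc 0 T, G t : ℝ) : ℂ) := by
    rw [integral_complex_ofReal, ← hG_tot, hsplitG]; push_cast; ring
  have hdecomp : haraC J x - ((gaussianAmp d / K₁ * r ^ (2 - (d : ℝ)) : ℝ) : ℂ) =
      (∫ t in Set.Ioc 0 T, I t) - ((∫ t in Set.Ioc 0 T, G t : ℝ) : ℂ) +
        ∫ t in Set.Ioi T, (I t - (G t : ℂ)) := by
    rw [hC, hsplitI, hIoiT, hGT]; ring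
  -- exponent bookkeeping: `T r^{-d} = r^{-s}` and `T^{a+1} ≤ r^{-s}`
  have hTr : r ^ (-(d : ℝ)) * T = r ^ (-s) := by
    rw [hT, ← Real.rpow_add hr0]; congr 1; rw [hs]; ring
  have hTa : T ^ (a + 1) ≤ r ^ (-s) := by
    rw [hT, ← Real.rpow_mul hr0.le]
    refine Real.rpow_le_rpow_of_exponent_le hr1 ?_
    -- `(2-σ)(a+1) ≤ -s`
    rw [ha, hs]
    have h1 : (2 - σ) * (-(((d : ℝ) + ρ') / 2) + 1) - (-((d : ℝ) - 2 + σ)) = -(ρ' / 2) * (1 - σ) := by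
      have : σ * (d : ℝ) = ρ' := hσd
      nlinarith [this]
    have h2 : -(ρ' / 2) * (1 - σ) ≤ 0 := by
      have : 0 ≤ 1 - σ := by linarith
      nlinarith
    linarith
  -- conclusion
  rw [hdecomp]
  have hKr : K₁ = ∑' y, euclidNorm y ^ 2 * J y := hK₁
  calc ‖(∫ t in Set.Ioc 0 T, I t) - ((∫ t in Set.Ioc 0 T, G t : ℝ) : ℂ) + ∫ t in Set.Ioi T, (I t - (G t : ℂ))‖
      ≤ ‖∫ t in Set.Ioc 0 T, I t‖ + ‖((∫ t in Set.Ioc 0 T, G t : ℝ) : ℂ)‖ + ‖∫ t in Set.Ioi T, (I t - (G t : ℂ))‖ := by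
        exact (norm_add_le _ _).trans (add_le_add (norm_sub_le _ _) le_rfl)
    _ ≤ c₆ * r ^ (-(d : ℝ)) * T + M₀ * r ^ (-(d : ℝ)) * T + c / (-(a + 1)) * T ^ (a + 1) := by
        refine add_le_add (add_le_add hE1 ?_) hE2
        rw [Complex.norm_real, Real.norm_eq_abs, abs_of_nonneg hE3.1]; exact hE3.2
    _ = (c₆ + M₀) * (r ^ (-(d : ℝ)) * T) + c / (-(a + 1)) * T ^ (a + 1) := by ring
    _ ≤ (c₆ + M₀) * r ^ (-s) + c / (-(a + 1)) * r ^ (-s) := by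
        rw [hTr]
        gcongr
        exact div_nonneg hc0 (by linarith)
    _ = (c₆ + c / (-(a + 1)) + M₀) * r ^ (-s) := by ring
    _ = (c₆ + c / (-(a + 1)) + M₀) * r ^ (-((d : ℝ) - 2 + min ρ 2 / d)) := by rw [hs, hσ, hρ']

end Literature.Barriers.CriticalPhenomena
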